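import Summits.CriticalPhenomena.PercolationContinuityZ3.Theorems.PercNearOneGluingNoHeavyConstsPinnedBinding
import Summits.CriticalPhenomena.PercolationContinuityZ3.Theorems.PercNearOneGluingNoHeavyConstsMarkerSplitRefutation
import HarnessLib

/-!
# REFUTATION of the pinned-binding conjecture `Consts.PinnedBinding` (∀ m form, p379027) — Part I: the witness, its cells, the failing conclusion
# (PAPER-2 track (ii); drop-in of the referee seat `prim-consts-3` gens 117–120, filed by `prim-consts-2` gen 25)

builds on p205010 (kernel theorem, internal audit signed; external expert review pending).  Support file (`--supports
stmt-CriticalPhenomena-4575`); reports `run/shared/lean/prim/consts/prim-consts-3/g117/REFEREE-g117.md`, `g118/…`, `g120/REFEREE-g120.md`;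
engines `prim-consts-3/g117/eng`, `g118/eng/pb_ref.py`, `g120/eng/pinned_cert_ref.py` (five independent exact derivations).
Every number below is an exact rational decided by the KERNEL (`decide +kernel`; no `native_decide`); no definitions of mathematical
content (Boolean event predicates on the `2⁹` configurations of the listed pairs, a cheap mass function, the witness functional and
the pencil constants), no named facts, no sorries.

THE CONJECTURE (`Consts.PinnedBinding`, `…ConstsPinnedBinding.lean`): for weights `α, β, γ ≥ 0` in the pencil `βb + γn ≤ αζ` and EVERY
level `m`, `Ψ = αI_Z − βI_{YZᶜ} − γI_N ≥ m` on the PINNED monotone 0/1 functionals of `C_s` implies `Ψ ≥ m` on all of them.  It is FALSE: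
THE WITNESS (g117 `witness_polished.json`): `n = 7`, `m = 9`, pairs `02 03 04 15 16 24 25 36 46` with weights
`1/2 19/100 1/2 19/100 1/2 499/500 499/500 19/20 91/100`, owner `s = 3`, markers `y = 4`, `z = 1`, `X = ∅`, `θ = 716959/771456`
(just above `θ_pin ≈ 0.928992`), `α = 1/ζ`, `β = θ/b`, `γ = (1−θ)/n`, level `m = m_pin = −121090912665244153513/3061344114529480941098880`
(the minimum of `Ψ` over the pinned functionals).  The NON-pinned cylinder `F = 1{s(0,3) ∈ C_s}` has `Ψ(F) − m_pin ≈ −1.585·10⁻⁶ < 0`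
(`conclusion_fails`), so `PinnedBinding` fails as soon as `m_pin ≤ Ψ(F′)` for every pinned `F′` — `not_pinnedBinding_of_pinnedHalf` (this file);
the pinned half is kernel-checked in Part II (`…ConstsPinnedBindingRefutation.lean`, `Consts.PinnedBindingCex.not_pinnedBinding`).
WHAT SURVIVES: the `m = 0` instance (the only one `Consts.crossM2_of_pinnedBinding` consumes) — retyped as `Consts.PinnedBinding₀`
(`…ConstsPinnedBindingZero.lean`); at this witness `min_all = 0` on the whole pencil (referee g120 §2, exact two-vertex decision).
METHOD: as in `…ConstsMarkerSplitRefutation.lean` — `FK.RCEval` at `q = 1` (`rcMeasureW w 1 ∅ = prodBernoulli w`), masses as `512`-term sums,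
events read by `FK.RCEval.reachB` (`reachB_iff`) and pair membership.
[cite: VandenbergHaggstromKahn2005, Thm. 1.3 (p. 6); §2.1 pp. 10–13]
-/

namespace Summit.CriticalPhenomena.PercolationContinuityZ3.Theorems

namespace Consts

namespace PinnedBindingCex

open MeasureTheory Literature.Probability.LatticeModels Literature.Probability.Percolation

/-- The witness as listed data (g117 `witness_polished.json`), `q = 1`. -/
abbrev G : FK.RCEval := ⟨7, 9, ![0, 0, 0, 1, 1, 2, 2, 3, 4], ![2, 3, 4, 5, 6, 4, 5, 6, 6],
  ![1 / 2, 19 / 100, 1 / 2, 19 / 100, 1 / 2, 499 / 500, 499 / 500, 19 / 20, 91 / 100], 1⟩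

/-- The listing is valid. [folklore] -/
theorem G_valid : G.Valid := by decide +kernel

/-- `Σ_t [P t]·∏_i (c_i or 1 − c_i)` (computable mass, no cluster count). [folklore] -/
def massW (P : Finset (Fin 9) → Bool) : ℚ := ∑ t : Finset (Fin 9), if P t then G.wQ t else 0

/-- At `q = 1`, `massQ = massW`. [folklore] -/
theorem massQ_eq_massW (P : Finset (Fin 9) → Bool) : G.massQ P = massW P := by
  unfold FK.RCEval.massQ massW FK.RCEval.mQ
  refine Finset.sum_congr rfl fun t _ => ?_
  have hq : G.q = 1 := rfl
  rw [hq, one_pow, mul_one]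

/-- At `q = 1`, `ZQ = massW ⊤`. [folklore] -/
theorem zq_eq : G.ZQ = massW (fun _ => true) := by
  unfold FK.RCEval.ZQ massW FK.RCEval.mQ
  refine Finset.sum_congr rfl fun t _ => ?_
  have hq : G.q = 1 := rfl
  rw [hq, one_pow, mul_one, if_pos rfl]

/-- Event predicate: the listed pair `1 = s(0,3)` is open. [folklore] -/
def pO (t : Finset (Fin 9)) : Bool := decide ((1 : Fin 9) ∈ t)
/-- Event predicate: `s = 3 ~ z = 1` (`Z`). [folklore] -/
def pZ (t : Finset (Fin 9)) : Bool := G.reachB t 3 1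
/-- Event predicate: `s ≁ z`, `s ~ y = 4` (`Y ∩ Zᶜ`). [folklore] -/
def pYZc (t : Finset (Fin 9)) : Bool := !G.reachB t 3 1 && G.reachB t 3 4
/-- Event predicate: `s ≁ z`, `s ≁ y` (`N = Yᶜ ∩ Zᶜ`). [folklore] -/
def pN (t : Finset (Fin 9)) : Bool := !G.reachB t 3 1 && !G.reachB t 3 4
/-- Event predicate: `Z ∩ {s(0,3) open}`. [folklore] -/
def pIZ (t : Finset (Fin 9)) : Bool := pZ t && pO t
/-- Event predicate: `Y ∩ Zᶜ ∩ {s(0,3) open}`. [folklore] -/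
def pIYZc (t : Finset (Fin 9)) : Bool := pYZc t && pO t
/-- Event predicate: `N ∩ {s(0,3) open}`. [folklore] -/
def pIN (t : Finset (Fin 9)) : Bool := pN t && pO t

/-! ### Kernel arithmetic (`decide +kernel`, `2⁹` configurations each) -/

set_option maxHeartbeats 0 in
/-- Total mass `1` (kernel). [folklore] -/
theorem massW_true : massW (fun _ => true) = 1 := by decide +kernel
set_option maxHeartbeats 0 in
/-- `μ(Z)` as an exact rational (kernel). [folklore] -/
theorem mass_Z : massW pZ = 280989204367 / 500000000000 := by decide +kernel
set_option maxHeartbeats 0 in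
/-- `μ(Y ∩ Zᶜ)` as an exact rational (kernel). [folklore] -/
theorem mass_YZc : massW pYZc = 14339253032209 / 40000000000000 := by decide +kernel
set_option maxHeartbeats 0 in
/-- `μ(Yᶜ ∩ Zᶜ)` as an exact rational (kernel). [folklore] -/
theorem mass_N : massW pN = 3181610618431 / 40000000000000 := by decide +kernel
set_option maxHeartbeats 0 in
/-- `μ(Z ∩ {s(0,3) open})` as an exact rational (kernel). [folklore] -/
theorem mass_IZ : massW pIZ = 4437510625067 / 40000000000000 := by decide +kernel
set_option maxHeartbeats 0 in
/-- `μ(Y ∩ Zᶜ ∩ {s(0,3) open})` as an exact rational (kernel). [folklore] -/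
theorem mass_IYZc : massW pIYZc = 1492989378251 / 20000000000000 := by decide +kernel
set_option maxHeartbeats 0 in
/-- `μ(Yᶜ ∩ Zᶜ ∩ {s(0,3) open})` as an exact rational (kernel). [folklore] -/
theorem mass_IN : massW pIN = 176510618431 / 40000000000000 := by decide +kernel

/-! ### Reading the events of `Consts.PinnedBinding` (at `X = ∅`) on the listed configurations -/

/-- Reachability in the open graph of a listed configuration is `reachB`. [folklore] -/
theorem reach_iff (t : Finset (Fin 9)) (a b : Fin 7) :
    (openGraph (G.conf t)).Reachable a b ↔ G.reachB t a b = true :=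
  (FK.RCEval.reachB_iff (D := G) t a b).symm

/-- `D = {s ↮ ∅}` is everything. [folklore] -/
theorem mem_D_iff (ω : BondConfig (Fin 7)) :
    (ω ∈ {ω : BondConfig (Fin 7) | ∀ x ∈ (∅ : Set (Fin 7)), ¬ (openGraph ω).Reachable 3 x}) ↔ True := by
  simp only [Set.mem_setOf_eq, Set.mem_empty_iff_false, false_imp_iff, imp_true_iff]

/-- `D_z = {s ↮ {z}}` is `s ≁ z`. [folklore] -/
theorem mem_Dz_iff (ω : BondConfig (Fin 7)) :
    (ω ∈ {ω : BondConfig (Fin 7) | ∀ x ∈ insert (1 : Fin 7) (∅ : Set (Fin 7)), ¬ (openGraph ω).Reachable 3 x}) ↔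
      ¬ (openGraph ω).Reachable 3 1 := by
  simp only [Set.mem_setOf_eq, Set.mem_insert_iff, Set.mem_empty_iff_false, or_false, forall_eq]

/-- The event `D = {s ↮ X}` of `Consts.PinnedBinding` at `X = ∅`, `s = 3`. [folklore] -/
abbrev sD : Set (BondConfig (Fin 7)) := {ω | ∀ x ∈ (∅ : Set (Fin 7)), ¬ (openGraph ω).Reachable 3 x}
/-- The event `{s ↮ X ∪ {z}}` at `X = ∅`, `s = 3`, `z = 1`. [folklore] -/
abbrev sDz : Set (BondConfig (Fin 7)) := {ω | ∀ x ∈ insert (1 : Fin 7) (∅ : Set (Fin 7)), ¬ (openGraph ω).Reachable 3 x}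
/-- The event `{s ↮ X ∪ {z}} ∩ {s ≁ y}` at `X = ∅`, `s = 3`, `z = 1`, `y = 4`. [folklore] -/
abbrev sN : Set (BondConfig (Fin 7)) :=
  {ω | (∀ x ∈ insert (1 : Fin 7) (∅ : Set (Fin 7)), ¬ (openGraph ω).Reachable 3 x) ∧ ¬ (openGraph ω).Reachable 3 4}
/-- The event `{s(0,3) open}`. [folklore] -/
abbrev sO : Set (BondConfig (Fin 7)) := {ω | s((0 : Fin 7), (3 : Fin 7)) ∈ ω}

/-- `s(0,3)` is open in the listed configuration `t` iff `pO t`. [folklore] -/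
theorem open03_iff (t : Finset (Fin 9)) : G.conf t ∈ sO ↔ pO t = true := by
  unfold pO FK.RCEval.conf
  rw [Set.mem_setOf_eq, Finset.mem_coe, Finset.mem_image, decide_eq_true_iff]
  constructor
  · rintro ⟨j, hj, hje⟩
    have key : ∀ j : Fin 9, G.edge j = s((0 : Fin 7), (3 : Fin 7)) → j = 1 := by decide
    rw [key j hje] at hj; exact hj
  · intro h; exact ⟨1, h, by decide⟩

/-- Reading `D ∩ Z` on listed configurations. [folklore] -/
theorem mem_Z (t : Finset (Fin 9)) : G.conf t ∈ (sD ∩ openConn 3 1) ↔ pZ t = true := by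
  rw [Set.mem_inter_iff, mem_D_iff, true_and]; unfold pZ openConn; rw [Set.mem_setOf_eq, reach_iff]

/-- Reading `D_z ∩ Y` on listed configurations. [folklore] -/
theorem mem_YZc (t : Finset (Fin 9)) : G.conf t ∈ (sDz ∩ openConn 3 4) ↔ pYZc t = true := by
  rw [Set.mem_inter_iff, mem_Dz_iff, CrossReachMeasureCex.not_iff_bnot (reach_iff t 3 1)]
  unfold pYZc openConn; rw [Set.mem_setOf_eq, reach_iff, Bool.and_eq_true]

/-- Reading `N` on listed configurations. [folklore] -/
theorem mem_N (t : Finset (Fin 9)) : G.conf t ∈ sN ↔ pN t = true := by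
  rw [Set.mem_setOf_eq]
  have h1 : (∀ x ∈ insert (1 : Fin 7) (∅ : Set (Fin 7)), ¬ (openGraph (G.conf t)).Reachable 3 x) ↔ ¬ (openGraph (G.conf t)).Reachable 3 1 :=
    mem_Dz_iff (G.conf t)
  rw [h1, CrossReachMeasureCex.not_iff_bnot (reach_iff t 3 1), CrossReachMeasureCex.not_iff_bnot (reach_iff t 3 4)]
  unfold pN; rw [Bool.and_eq_true]

/-- Reading `D ∩ Z ∩ O` on listed configurations. [folklore] -/
theorem mem_IZ (t : Finset (Fin 9)) : G.conf t ∈ (sD ∩ openConn 3 1 ∩ sO) ↔ pIZ t = true := by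
  rw [Set.mem_inter_iff, mem_Z, open03_iff]; unfold pIZ; rw [Bool.and_eq_true]

/-- Reading `D_z ∩ Y ∩ O` on listed configurations. [folklore] -/
theorem mem_IYZc (t : Finset (Fin 9)) : G.conf t ∈ (sDz ∩ openConn 3 4 ∩ sO) ↔ pIYZc t = true := by
  rw [Set.mem_inter_iff, mem_YZc, open03_iff]; unfold pIYZc; rw [Bool.and_eq_true]

/-- Reading `N ∩ O` on listed configurations. [folklore] -/
theorem mem_IN (t : Finset (Fin 9)) : G.conf t ∈ (sN ∩ sO) ↔ pIN t = true := by
  rw [Set.mem_inter_iff, mem_N, open03_iff]; unfold pIN; rw [Bool.and_eq_true]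

/-! ### The six cells as real numbers -/

/-- At `q = 1` the random-cluster evaluation measure is `prodBernoulli`. [folklore] -/
theorem rc_eq : rcMeasureW G.w ((G.q : ℚ) : ℝ) ∅ = prodBernoulli G.w := by
  have : ((G.q : ℚ) : ℝ) = 1 := by norm_num [G]
  rw [this]; exact rcMeasureW_one G.w ∅

/-- The cell `ζ = μ(D ∩ Z)` (kernel). [folklore] -/
theorem real_Z : (prodBernoulli G.w).real (sD ∩ openConn 3 1) = ((280989204367 / 500000000000 : ℚ) : ℝ) := by
  have h := FK.RCEval.real_eq_massQ_div G_valid (mem_Z)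
  rw [rc_eq, massQ_eq_massW, mass_Z, zq_eq, massW_true, div_one] at h; exact h
/-- The cell `b = μ(D_z ∩ Y)` (kernel). [folklore] -/
theorem real_YZc : (prodBernoulli G.w).real (sDz ∩ openConn 3 4) = ((14339253032209 / 40000000000000 : ℚ) : ℝ) := by
  have h := FK.RCEval.real_eq_massQ_div G_valid (mem_YZc)
  rw [rc_eq, massQ_eq_massW, mass_YZc, zq_eq, massW_true, div_one] at h; exact h
/-- The cell `n = μ(N)` (kernel). [folklore] -/
theorem real_N : (prodBernoulli G.w).real sN = ((3181610618431 / 40000000000000 : ℚ) : ℝ) := by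
  have h := FK.RCEval.real_eq_massQ_div G_valid (mem_N)
  rw [rc_eq, massQ_eq_massW, mass_N, zq_eq, massW_true, div_one] at h; exact h
/-- The cell `μ(D ∩ Z ∩ O)` (kernel). [folklore] -/
theorem real_IZ : (prodBernoulli G.w).real (sD ∩ openConn 3 1 ∩ sO) = ((4437510625067 / 40000000000000 : ℚ) : ℝ) := by
  have h := FK.RCEval.real_eq_massQ_div G_valid (mem_IZ)
  rw [rc_eq, massQ_eq_massW, mass_IZ, zq_eq, massW_true, div_one] at h; exact h
/-- The cell `μ(D_z ∩ Y ∩ O)` (kernel). [folklore] -/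
theorem real_IYZc : (prodBernoulli G.w).real (sDz ∩ openConn 3 4 ∩ sO) = ((1492989378251 / 20000000000000 : ℚ) : ℝ) := by
  have h := FK.RCEval.real_eq_massQ_div G_valid (mem_IYZc)
  rw [rc_eq, massQ_eq_massW, mass_IYZc, zq_eq, massW_true, div_one] at h; exact h
/-- The cell `μ(N ∩ O)` (kernel). [folklore] -/
theorem real_IN : (prodBernoulli G.w).real (sN ∩ sO) = ((176510618431 / 40000000000000 : ℚ) : ℝ) := by
  have h := FK.RCEval.real_eq_massQ_div G_valid (mem_IN)
  rw [rc_eq, massQ_eq_massW, mass_IN, zq_eq, massW_true, div_one] at h; exact h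

/-! ### The (non-pinned) cylinder functional `F = 1{s(0,3) ∈ C_s}` -/

open scoped Classical in
/-- The non-pinned cylinder functional `F = 1{s(0,3) ∈ C}`. [folklore] -/
noncomputable def F (C : Set (Sym2 (Fin 7))) : ℝ := if s((0 : Fin 7), (3 : Fin 7)) ∈ C then 1 else 0

/-- `F` is monotone. [folklore] -/
theorem F_mono : Monotone F := by
  intro C C' h; unfold F
  by_cases hc : s((0 : Fin 7), (3 : Fin 7)) ∈ C
  · rw [if_pos hc, if_pos (h hc)]
  · rw [if_neg hc]; split_ifs <;> norm_num

/-- `F` is 0/1-valued. [folklore] -/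
theorem F_zero_one (C : Set (Sym2 (Fin 7))) : F C = 0 ∨ F C = 1 := by unfold F; split_ifs <;> simp

/-- `s(0,3) ∈ C_s(ω)` iff `s(0,3)` is open (the pair is at the owner `s = 3`). [folklore] -/
theorem mem_cluster_iff (ω : BondConfig (Fin 7)) :
    s((0 : Fin 7), (3 : Fin 7)) ∈ openEdgeCluster ω 3 ↔ s((0 : Fin 7), (3 : Fin 7)) ∈ ω := by
  rw [mem_openEdgeCluster_iff]
  constructor
  · exact fun h => h.1
  · intro h
    have h03 : (0 : Fin 7) ≠ 3 := by decide
    refine ⟨h, ?_, ?_⟩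
    · rw [Sym2.mk_isDiag_iff]; exact h03
    · intro v hv
      rcases Sym2.mem_iff.1 hv with rfl | rfl
      · have hadj : (openGraph ω).Adj 3 0 := by
          unfold openGraph; rw [SimpleGraph.fromEdgeSet_adj]
          exact ⟨by rw [Sym2.eq_swap]; exact h, h03.symm⟩
        exact hadj.reachable
      · exact SimpleGraph.Reachable.refl _

/-- `F(C_s(ω)) = 1_O(ω)`. [folklore] -/
theorem F_cluster (ω : BondConfig (Fin 7)) : F (openEdgeCluster ω 3) = sO.indicator 1 ω := by
  unfold F
  by_cases h : s((0 : Fin 7), (3 : Fin 7)) ∈ ω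
  · rw [if_pos ((mem_cluster_iff ω).2 h), Set.indicator_of_mem (show ω ∈ sO from h), Pi.one_apply]
  · rw [if_neg (fun h' => h ((mem_cluster_iff ω).1 h')), Set.indicator_of_notMem (show ω ∉ sO from h)]

/-- `∫_S F(C_s) dμ = μ(S ∩ O)`. [folklore] -/
theorem integral_F (S : Set (BondConfig (Fin 7))) :
    ∫ ω in S, F (openEdgeCluster ω 3) ∂(prodBernoulli G.w) = (prodBernoulli G.w).real (S ∩ sO) := by
  simp_rw [F_cluster]; exact TripodExchange.setIntegral_indicator_one_eq _ _ _

/-! ### The pencil and the failing conclusion -/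

/-- `θ`, `α = 1/ζ`, `β = θ/b`, `γ = (1−θ)/n₀`, and the pinned minimum `m_pin`. -/
noncomputable abbrev θ : ℝ := 716959 / 771456
/-- `α = 1/ζ`. [folklore] -/
noncomputable abbrev α : ℝ := 500000000000 / 280989204367
/-- `β = θ/b`. [folklore] -/
noncomputable abbrev β : ℝ := θ * (40000000000000 / 14339253032209)
/-- `γ = (1 − θ)/n`. [folklore] -/
noncomputable abbrev γ : ℝ := (1 - θ) * (40000000000000 / 3181610618431)
/-- The pinned minimum `m_pin` of `Ψ` at the witness (exact; g117 flow certificate, g120 kernel certificate). [folklore] -/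
noncomputable abbrev mpin : ℝ := -121090912665244153513 / 3061344114529480941098880

/-- `0 ≤ α`. [folklore] -/
theorem α_nonneg : 0 ≤ α := by norm_num
/-- `0 ≤ β`. [folklore] -/
theorem β_nonneg : 0 ≤ β := by norm_num
/-- `0 ≤ γ`. [folklore] -/
theorem γ_nonneg : 0 ≤ γ := by norm_num

/-- The pencil hypothesis of `Consts.PinnedBinding` holds (with equality) at the witness. -/
theorem pencil :
    β * (prodBernoulli G.w).real (sDz ∩ openConn 3 4) + γ * (prodBernoulli G.w).real sN ≤
      α * (prodBernoulli G.w).real (sD ∩ openConn 3 1) := by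
  rw [real_YZc, real_N, real_Z]; norm_num

/-- **The CONCLUSION of `Consts.PinnedBinding` fails at the non-pinned cylinder `F`**: `Ψ(F) < m_pin`
(`Ψ(F) − m_pin = −41802857572730560171566285659227/26371522813193547297477614935817530560 ≈ −1.585·10⁻⁶`). -/
theorem conclusion_fails :
    ¬ (mpin ≤ α * (∫ ω in sD ∩ openConn 3 1, F (openEdgeCluster ω 3) ∂(prodBernoulli G.w)) -
          β * (∫ ω in sDz ∩ openConn 3 4, F (openEdgeCluster ω 3) ∂(prodBernoulli G.w)) -
          γ * (∫ ω in sN, F (openEdgeCluster ω 3) ∂(prodBernoulli G.w))) := by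
  rw [integral_F, integral_F, integral_F, real_IZ, real_IYZc, real_IN]; norm_num

/-- **`Consts.PinnedBinding` (∀ m form) REDUCES to the pinned half at the witness**: if `m_pin ≤ Ψ(F′)` for every PINNED monotone 0/1 `F′`
(kernel-checked in Part II, `…ConstsPinnedBindingRefutation.lean`, from a 225-arc flow certificate), then `PinnedBinding` is false, because its
conclusion fails at the non-pinned cylinder `F = 1{s(0,3) ∈ C_s}` (`conclusion_fails`). -/
theorem not_pinnedBinding_of_pinnedHalf
    (hpin : ∀ F : Set (Sym2 (Fin 7)) → ℝ, Monotone F → (∀ C, F C = 0 ∨ F C = 1) →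
      (∀ ω : BondConfig (Fin 7), F (openEdgeCluster ω 3) = 1 → (openGraph ω).Reachable 3 4) →
      mpin ≤ α * (∫ ω in sD ∩ openConn 3 1, F (openEdgeCluster ω 3) ∂(prodBernoulli G.w)) -
          β * (∫ ω in sDz ∩ openConn 3 4, F (openEdgeCluster ω 3) ∂(prodBernoulli G.w)) -
          γ * (∫ ω in sN, F (openEdgeCluster ω 3) ∂(prodBernoulli G.w))) :
    ¬ PinnedBinding := by
  intro hPB
  exact conclusion_fails (hPB 7 G.w 3 4 1 ∅ α β γ mpin α_nonneg β_nonneg γ_nonneg pencil hpin F F_mono F_zero_one)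

/-! ## The abstract LP-duality certificate lemma (used by Part II) -/

namespace Pinned

/-- Out-flow of a real arc list. [folklore] -/
def outF (L : List (Fin 512 × Fin 512 × ℝ)) (c : Fin 512) : ℝ := (L.map fun a => if a.1 = c then a.2.2 else 0).sum
/-- In-flow of a real arc list. [folklore] -/
def inF (L : List (Fin 512 × Fin 512 × ℝ)) (c : Fin 512) : ℝ := (L.map fun a => if a.2.1 = c then a.2.2 else 0).sum

/-- Flow conservation identity `Σ_c (in_c − out_c)·x_c = Σ_arcs λ·(x_head − x_tail)`. [folklore] -/
theorem flow_identity (L : List (Fin 512 × Fin 512 × ℝ)) (x : Fin 512 → ℝ) :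
    ∑ c, (inF L c - outF L c) * x c = (L.map fun a => a.2.2 * (x a.2.1 - x a.1)).sum := by
  induction L with
  | nil => simp [inF, outF]
  | cons a L ih =>
    have hin : ∀ c, inF (a :: L) c = (if a.2.1 = c then a.2.2 else 0) + inF L c := fun c => by simp [inF]
    have hout : ∀ c, outF (a :: L) c = (if a.1 = c then a.2.2 else 0) + outF L c := fun c => by simp [outF]
    simp only [hin, hout, List.map_cons, List.sum_cons]
    rw [← ih]
    have : ∀ c, ((if a.2.1 = c then a.2.2 else 0) + inF L c - ((if a.1 = c then a.2.2 else 0) + outF L c)) * x c =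
        (if a.2.1 = c then a.2.2 * x c else 0) - (if a.1 = c then a.2.2 * x c else 0) + (inF L c - outF L c) * x c := by
      intro c; split_ifs <;> ring
    simp only [this, Finset.sum_add_distrib, Finset.sum_sub_distrib, Finset.sum_ite_eq, Finset.mem_univ, if_true]
    ring

/-- **The abstract LP-duality certificate lemma**: for `x ∈ [0,1]^512` monotone along the arcs and `0` off the pinned codes, `Σ ψ_c x_c ≥ Σ_{pinned} min(ψ_c + out_c − in_c, 0)`. [folklore] -/
theorem cert_bound (ψ : Fin 512 → ℝ) (pin : Fin 512 → Bool) (L : List (Fin 512 × Fin 512 × ℝ))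
    (hL : ∀ a ∈ L, 0 ≤ a.2.2) (x : Fin 512 → ℝ) (hx0 : ∀ c, 0 ≤ x c) (hx1 : ∀ c, x c ≤ 1)
    (hpin : ∀ c, pin c = false → x c = 0) (hmono : ∀ a ∈ L, x a.1 ≤ x a.2.1) :
    (∑ c, if pin c then min (ψ c + outF L c - inF L c) 0 else 0) ≤ ∑ c, ψ c * x c := by
  have hflow : 0 ≤ (L.map fun a => a.2.2 * (x a.2.1 - x a.1)).sum := by
    apply List.sum_nonneg
    intro r hr
    obtain ⟨a, ha, rfl⟩ := List.mem_map.1 hr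
    exact mul_nonneg (hL a ha) (sub_nonneg.2 (hmono a ha))
  have hsplit : ∑ c, ψ c * x c = ∑ c, (ψ c + outF L c - inF L c) * x c + ∑ c, (inF L c - outF L c) * x c := by
    rw [← Finset.sum_add_distrib]; refine Finset.sum_congr rfl fun c _ => ?_; ring
  rw [hsplit, flow_identity]
  refine le_trans ?_ (le_add_of_nonneg_right hflow)
  refine Finset.sum_le_sum fun c _ => ?_
  cases hp : pin c with
  | false => rw [hpin c hp, mul_zero]; simp
  | true =>
    simp only [if_true]
    rcases le_or_gt 0 (ψ c + outF L c - inF L c) with h | h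
    · exact le_trans (min_le_right _ _) (mul_nonneg h (hx0 c))
    · calc min (ψ c + outF L c - inF L c) 0 ≤ ψ c + outF L c - inF L c := min_le_left _ _
        _ = (ψ c + outF L c - inF L c) * 1 := (mul_one _).symm
        _ ≤ (ψ c + outF L c - inF L c) * x c := mul_le_mul_of_nonpos_left (hx1 c) h.le

end Pinned

end PinnedBindingCex

end Consts

end Summit.CriticalPhenomena.PercolationContinuityZ3.Theorems
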